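import Literature.Probability.Process.BrownianVecModel
import Mathlib.Analysis.InnerProductSpace.PiL2
import Mathlib.Topology.MetricSpace.Closeds
import Mathlib.MeasureTheory.Constructions.BorelSpace.Basic
import HarnessLib

/-!
# The range of Brownian motion in `ℝ³` conditioned to hit a point: its law as a random compact
set (Doob `h`-transform by the Newton kernel, in the Brownian-bridge mixture form)

Topic `Literature/Probability/Process`; DEFINITIONS with bodies (no named fact), requested as the
definition item `defn-brownianBridgeToPointRangeLaw3` by the route
`Summit.CriticalPhenomena.Ising3DConformalLimit.Theses.MoebiusRestrictionCurrents` (support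
statement `KelvinBridgeCovariance`, `stmt-CriticalPhenomena-5033`: the push-forward of the law from
`x` to `y` under the unit inversion is the law from `ιx` to `ιy`).

## The object

For `x ≠ y` in `ℝ³`, Brownian motion started at `x` and Doob-`h`-transformed by the Newton kernel
`h(z) = ‖z − y‖⁻¹` ("conditioned to hit the polar point `y`") reaches `y` at an a.s. finite time
`T_y` and is killed there (Doob 1984, Part 2, Ch. X, §§1–4, `h`-path processes for `h = G(·, y)`;
Port–Stone 1978, Ch. 3). Its law is the **mixture of Brownian bridges**: the lifetime `T_y` has
density `p_t(x, y) / G(x, y)` on `(0, ∞)` — `p_t(x,y) = (2πt)^{-3/2} exp(−‖x−y‖²/2t)` the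
transition density of standard Brownian motion (generator `½Δ`), `G(x, y) = ∫₀^∞ p_t(x,y) dt =
(2π‖x − y‖)⁻¹` its Green (Newton) kernel — and conditionally on `T_y = t` the path is a Brownian
bridge of duration `t` from `x` to `y` (Fitzsimmons–Pitman–Yor 1993, §2 and Prop. 1, the bridge
decomposition of the `h`-transform by a Green function; Revuz–Yor, Ch. XI for the Bessel-process
picture). A Brownian bridge of duration `t` from `x` to `y` is realised from a standard Brownian
motion `B` as `X_s = x + (s/t)(y − x) + (B_s − (s/t)B_t)`, `0 ≤ s ≤ t`.

## Rendering

Everything is built on the tree's CONCRETE model of four-dimensional Brownian motion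
(`Process.brownianQuad` on `(WienerQuad, wienerQuad)`, `isBrownianVec_brownianQuad`: continuous
paths for every sample, Gaussian marginals, weak Markov property), of which the last three
coordinates serve as the standard Brownian motion `B` in `ℝ³` (`bm3`; a coordinate projection of a
Brownian motion is a Brownian motion):

* `bm3`, `bridgePath t x y ω`, `bridgeRange t x y ω : NonemptyCompacts (EuclideanSpace ℝ (Fin 3))`
  (the range `{X_s : 0 ≤ s ≤ t}` of the bridge path, compact and nonempty because the path is
  continuous for EVERY `ω`);
* `heatKernel3 t x y = p_t(x,y)`, `hittingDensity x y t = 2π‖x−y‖ · p_t(x,y)` and the lifetime law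
  `hittingTimeLaw x y` (Lebesgue measure on `(0,∞)` with that density);
* `brownianBridgeToPointRangeLaw3 x y` — THE REQUESTED NOTION: the image of the product measure
  `wienerQuad ⊗ hittingTimeLaw x y` under `(ω, t) ↦ bridgeRange t x y ω`, a Borel measure on the
  Hausdorff space `NonemptyCompacts (EuclideanSpace ℝ (Fin 3))` (Borel σ-algebra of the Hausdorff
  metric, instances below, as for `NonemptyCompacts ℂ` in `Percolation/OneArmScalingLimit.lean`);
  junk value `0` for `x = y` (as requested).

## Caveats recorded, not hidden

* `Measure.map` of a non-a.e.-measurable map is `0`; the map `(ω, t) ↦ bridgeRange t x y ω` IS Borel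
  measurable (the range is the closure of the countable set of values at rational times, and the
  Hausdorff Borel σ-algebra is generated by the maps `K ↦ infDist z K`), but this is NOT proved
  here, so the definition carries that proof obligation for whoever needs `map_apply`.
* `hittingTimeLaw x y` is a probability measure exactly by the Green identity
  `∫₀^∞ (2πt)^{-3/2} e^{−r²/2t} dt = (2πr)⁻¹` (substitute `s = 1/t`, `Γ(1/2) = √π`); not proved here
  (`hittingDensity_nonneg` is).
* The identification "`h`-transform killed at `T_y` = bridge mixture" is the cited theorem
  (Fitzsimmons–Pitman–Yor 1993, Prop. 1 / Doob 1984, 2.X); the definition takes the mixture as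
  primary, which is the form in which the inversion covariance is proved (time reversal of bridges
  + Kelvin transform of `p_t`).

## References

* J. L. Doob, *Classical Potential Theory and Its Probabilistic Counterpart*, Springer 1984,
  Part 2, Ch. X (conditional Brownian motion, `h`-path processes). [Doob1984]
* S. C. Port, C. J. Stone, *Brownian Motion and Classical Potential Theory*, Academic Press 1978,
  Ch. 3. [PortStone1978]
* P. Fitzsimmons, J. Pitman, M. Yor, *Markovian bridges: construction, Palm interpretation, and
  splicing*, in: Seminar on Stochastic Processes 1992, Birkhäuser 1993, §2, Prop. 1.
* D. Revuz, M. Yor, *Continuous Martingales and Brownian Motion*, 3rd ed., Ch. XI. [RevuzYor1999]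
-/

noncomputable section

open MeasureTheory TopologicalSpace Set
open scoped NNReal Real ENNReal

namespace Literature.Probability.Process

/-- Euclidean `3`-space. [folklore] -/
abbrev E3 : Type := EuclideanSpace ℝ (Fin 3)

/-! ### The Hausdorff space of nonempty compact subsets of `ℝ³` as a Borel space -/

/-- The Borel σ-algebra of the Hausdorff metric on nonempty compact subsets of `ℝ³` (random compact
sets; cf. `Percolation.instMeasurableSpaceNonemptyCompacts` for `ℂ`). [folklore] -/
instance instMeasurableSpaceNonemptyCompactsE3 : MeasurableSpace (NonemptyCompacts E3) := borel _

/-- `NonemptyCompacts ℝ³` with the σ-algebra above is a Borel space (by definition). [folklore] -/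
instance instBorelSpaceNonemptyCompactsE3 : BorelSpace (NonemptyCompacts E3) := ⟨rfl⟩

/-! ### A standard Brownian motion in `ℝ³` and the Brownian bridge -/

/-- **Standard Brownian motion in `ℝ³`** on the tree's model space `(WienerQuad, wienerQuad)`: the
last three coordinates of the four-dimensional Brownian motion `brownianQuad`
(`isBrownianVec_brownianQuad`), as a point of `EuclideanSpace ℝ (Fin 3)`. [folklore] -/
def bm3 (t : ℝ≥0) (ω : WienerQuad) : E3 :=
  (EuclideanSpace.equiv (Fin 3) ℝ).symm fun i ↦ brownianQuad t ω i.succ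

/-- Every sample path of `bm3` is continuous. [folklore] -/
theorem continuous_bm3 (ω : WienerQuad) : Continuous fun t ↦ bm3 t ω := by
  unfold bm3
  refine (EuclideanSpace.equiv (Fin 3) ℝ).symm.continuous.comp ?_
  exact continuous_pi fun i ↦
    (continuous_apply i.succ).comp (isBrownianVec_brownianQuad.continuous_path ω)

/-- **The Brownian bridge path of duration `t` from `x` to `y`** driven by `bm3`:
`X_s = x + (s/t)(y − x) + (B_s − (s/t) B_t)` for `0 ≤ s ≤ t` (the formula is used for all
`s ≥ 0`; only `s ∈ [0, t]` matters). For `t = 0` the drift terms vanish (`s/0 = 0`).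
[cite: RevuzYor1999, Ch. I (Brownian bridge as `B_s − (s/t)B_t`)] -/
def bridgePath (t : ℝ≥0) (x y : E3) (ω : WienerQuad) (s : ℝ≥0) : E3 :=
  x + ((s : ℝ) / t) • (y - x) + (bm3 s ω - ((s : ℝ) / t) • bm3 t ω)

/-- The bridge path is continuous in `s` (every sample). [folklore] -/
theorem continuous_bridgePath (t : ℝ≥0) (x y : E3) (ω : WienerQuad) :
    Continuous (bridgePath t x y ω) := by
  unfold bridgePath
  have hc : Continuous fun s : ℝ≥0 ↦ ((s : ℝ) / t) := NNReal.continuous_coe.div_const _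
  have hb : Continuous fun s : ℝ≥0 ↦ bm3 s ω := continuous_bm3 ω
  exact (continuous_const.add (hc.smul continuous_const)).add (hb.sub (hc.smul continuous_const))

/-- The bridge starts at `x` (using `B₀ = 0`). [folklore] -/
theorem bridgePath_zero (t : ℝ≥0) (x y : E3) (ω : WienerQuad) : bridgePath t x y ω 0 = x := by
  have h0 : bm3 0 ω = 0 := by
    unfold bm3
    have := isBrownianVec_brownianQuad.apply_zero ω
    simp only [this, Pi.zero_apply]
    exact map_zero _
  simp [bridgePath, h0]

/-- The bridge of positive duration `t` ends at `y`. [folklore] -/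
theorem bridgePath_self {t : ℝ≥0} (ht : t ≠ 0) (x y : E3) (ω : WienerQuad) :
    bridgePath t x y ω t = y := by
  have h1 : ((t : ℝ) / t) = 1 := div_self (NNReal.coe_ne_zero.2 ht)
  simp [bridgePath, h1]

/-- **The range of the Brownian bridge** `{X_s : 0 ≤ s ≤ t}` as a nonempty compact subset of `ℝ³`
(compact and nonempty for EVERY sample, the path being continuous). [folklore] -/
def bridgeRange (t : ℝ≥0) (x y : E3) (ω : WienerQuad) : NonemptyCompacts E3 where
  carrier := bridgePath t x y ω '' Icc 0 t
  isCompact' := isCompact_Icc.image (continuous_bridgePath t x y ω)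
  nonempty' := (nonempty_Icc.2 bot_le).image _

/-- The starting point belongs to the range. [folklore] -/
theorem start_mem_bridgeRange (t : ℝ≥0) (x y : E3) (ω : WienerQuad) :
    x ∈ (bridgeRange t x y ω : Set E3) :=
  ⟨0, ⟨le_rfl, bot_le⟩, bridgePath_zero t x y ω⟩

/-- For positive duration the end point `y` belongs to the range. [folklore] -/
theorem end_mem_bridgeRange {t : ℝ≥0} (ht : t ≠ 0) (x y : E3) (ω : WienerQuad) :
    y ∈ (bridgeRange t x y ω : Set E3) :=
  ⟨t, ⟨bot_le, le_rfl⟩, bridgePath_self ht x y ω⟩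

/-! ### The heat kernel, the lifetime law, and the requested law -/

/-- **The transition density of standard Brownian motion in `ℝ³`** (generator `½Δ`):
`p_t(x, y) = (2πt)^{-3/2} exp(−‖x − y‖² / 2t)`. [folklore] -/
def heatKernel3 (t : ℝ) (x y : E3) : ℝ :=
  (2 * π * t) ^ (-(3 : ℝ) / 2) * Real.exp (-‖x - y‖ ^ 2 / (2 * t))

/-- The heat kernel is nonnegative. [folklore] -/
theorem heatKernel3_nonneg {t : ℝ} (ht : 0 ≤ t) (x y : E3) : 0 ≤ heatKernel3 t x y :=
  mul_nonneg (Real.rpow_nonneg (by positivity) _) (Real.exp_nonneg _)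

/-- The heat kernel is symmetric in `x, y`. [folklore] -/
theorem heatKernel3_comm (t : ℝ) (x y : E3) : heatKernel3 t x y = heatKernel3 t y x := by
  simp [heatKernel3, norm_sub_rev]

/-- **Density of the lifetime `T_y`** of Brownian motion from `x` conditioned (by `‖· − y‖⁻¹`) to hit
`y`: `t ↦ p_t(x,y) / G(x,y) = 2π‖x − y‖ · p_t(x, y)` on `t > 0`, where `G(x,y) = (2π‖x−y‖)⁻¹` is the
Green kernel `∫₀^∞ p_t(x,y) dt` of standard Brownian motion in `ℝ³`. [cite: PortStone1978, Ch. 3 (Green function of Brownian motion in ℝ³)] -/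
def hittingDensity (x y : E3) (t : ℝ) : ℝ :=
  2 * π * ‖x - y‖ * heatKernel3 t x y

/-- The lifetime density is nonnegative on `t ≥ 0`. [folklore] -/
theorem hittingDensity_nonneg {t : ℝ} (ht : 0 ≤ t) (x y : E3) : 0 ≤ hittingDensity x y t :=
  mul_nonneg (by positivity) (heatKernel3_nonneg ht x y)

/-- The lifetime density is symmetric in `x, y` (time reversal of bridges). [folklore] -/
theorem hittingDensity_comm (x y : E3) (t : ℝ) : hittingDensity x y t = hittingDensity y x t := by
  simp [hittingDensity, heatKernel3_comm, norm_sub_rev]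

/-- **The law of the lifetime `T_y`**: Lebesgue measure on `(0, ∞)` with density
`hittingDensity x y` (a probability measure by the Green identity, module docstring).
[cite: PortStone1978, Ch. 3] -/
def hittingTimeLaw (x y : E3) : Measure ℝ :=
  (volume.restrict (Ioi (0 : ℝ))).withDensity fun t ↦ ENNReal.ofReal (hittingDensity x y t)

/-- **The law of the range of Brownian motion in `ℝ³` from `x` conditioned to hit `y`**
(`h`-transform by the Newton kernel `‖· − y‖⁻¹`, killed at the hitting time `T_y`; Doob 1984, Part 2,
Ch. X; Port–Stone 1978, Ch. 3), as a Borel measure on the Hausdorff space of nonempty compact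
subsets of `ℝ³`, in the BRIDGE-MIXTURE form: sample the lifetime `t` from `hittingTimeLaw x y`
(density `p_t(x,y)/G(x,y)`) and independently a standard Brownian motion, and take the range of
the Brownian bridge of duration `t` from `x` to `y`. Junk value `0` when `x = y` (the conditioning
is undefined there). [cite: Doob1984, Part 2 Ch. X (h-path processes for h = G(·,y))] -/
def brownianBridgeToPointRangeLaw3 (x y : E3) : Measure (NonemptyCompacts E3) :=
  if x = y then 0 else
    (wienerQuad.prod (hittingTimeLaw x y)).map fun p ↦ bridgeRange p.2.toNNReal x y p.1

/-- Unfolding for `x ≠ y`. [folklore] -/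
theorem brownianBridgeToPointRangeLaw3_of_ne {x y : E3} (h : x ≠ y) :
    brownianBridgeToPointRangeLaw3 x y =
      (wienerQuad.prod (hittingTimeLaw x y)).map fun p ↦ bridgeRange p.2.toNNReal x y p.1 := by
  simp [brownianBridgeToPointRangeLaw3, h]

/-- The junk value at `x = y`. [folklore] -/
@[simp] theorem brownianBridgeToPointRangeLaw3_self (x : E3) :
    brownianBridgeToPointRangeLaw3 x x = 0 := by
  simp [brownianBridgeToPointRangeLaw3]

end Literature.Probability.Process
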